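import Summits.QuantumFields.YangMills.Theorems.VirialFluxGapRingFrameBasis
import Literature.MathematicalPhysics.QuantumFieldTheory.Federbush1986.PureAveragesUNGauss
import HarnessLib

/-!
# Route `VirialFluxGap` (YangMills): the SU(2) LOGARITHM LETTER for the ring group — a nearby ring history is a multi-direction translate
# `Q = P·exp(Y)` with `‖Y_w‖_F ≤ 2‖Q_w − P_w‖_F`, and its standard coordinates (input (ii) of the generic-region master estimates)

Toward the deciding crux `VirialFluxGap.PeriodicSoftness` (item stmt-QuantumFields-24141), generic-region Euler field (memo
`fcl-p3-g40-RESOLVENT-EULER-FIELD-24141.md`).  The master estimates ✓`FrameHessian.generic_drive_lower` ∕ ✓`generic_divergence_upper` take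
coordinates `u` with `P·exp(Σ u_j τ_j)` a zero of `F₀` and `κ|u|² ≤ F₀(P)`.  This file turns a NEARBY zero `Q` (slot by slot within Frobenius
distance `< 1/4`, e.g. w2's ✓`RegularValley.exists_flat_ring_near_of_far`) into such coordinates:

* §1 ★ `su2_log_letter` — for `A, B ∈ SU(2)` with `‖B − A‖_F < 1/4` the matrix logarithm `Y = log(AᴴB)` (Bałaban's series ✓`MatrixLog.mlog`)
  is skew-Hermitian (✓`UNGauss.star_mlog_of_mem_unitaryGroup`), TRACELESS (`det e^Y = e^{tr Y} = 1` and `|tr Y| < 2π`), satisfies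
  `A·e^Y = B` and `‖Y‖_F ≤ 2‖B − A‖_F`;
* §2 ★★ `exists_multiCurve_eq_of_near` — for ring histories `P, Q` with `‖Q_w − P_w‖_F < 1/4` at every slice link and seam site there is a skew-Hermitian
  traceless assignment `Y` with `P·multiCurve Y 1 = Q` and `‖Y_w‖ ≤ 2‖Q_w − P_w‖` slot by slot;
* §3 ★★ `exists_stdCoord_of_near` — hence standard coordinates `u = stdCoord Y` with `dirOf stdFrame u = Y` (so `P·exp(Σu_jτ_j) = Q`) and
  `|u|² ≤ 48·Σ_w ‖Q_w − P_w‖²` (✓`stdCoord_sq_le`).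

HONEST FRAMING: bookkeeping letter; the combination with ✓`exists_flat_ring_near_of_far` into an explicit `κ = ρ²/poly(L)` and the kernel
family are NOT here; ⟨24141⟩ stays OPEN; no stub / crux / rung / summit is closed; the Yang–Mills mass gap is NOT proved; no summit is proved by a
line.  THEOREMS ONLY (0 `def`, 0 `sorry`), standard axioms.  Explicit-unit seat `ym-line-fcl-p3` g40 (cell ym-idea-1, free hands),
`--supports stmt-QuantumFields-24141`.  References: [cite: Balaban1985Averaging, (21), (26) p. 21–22] (matrix logarithm); [folklore].
-/

set_option autoImplicit false

noncomputable section

open scoped Matrix BigOperators ContDiff Topology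
open MeasureTheory Set Matrix
open Literature.MathematicalPhysics.QuantumFieldTheory hiding SU2
open Literature.MathematicalPhysics.QuantumLattice
open Literature.MathematicalPhysics.QuantumFieldTheory.SUNBakryEmery (expSU coe_expSU matTop)
open Literature.MathematicalPhysics.QuantumFieldTheory.Balaban1983to89.MatrixLog (mlog exp_mlog norm_mlog_le_two_mul)
open Literature.MathematicalPhysics.QuantumFieldTheory.Federbush1986.UNGauss (star_mlog_of_mem_unitaryGroup)

namespace Summit.QuantumFields.YangMills.Theorems.VirialFluxGap.FrameHessian

open Summit.QuantumFields.YangMills.Theorems.FemtoTransferGap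
open Summit.QuantumFields.YangMills.Theorems.FemtoTransferGap.TT
open Summit.QuantumFields.YangMills.Theorems.VirialFluxGap.RingDeficit
open Summit.QuantumFields.YangMills.Theorems.VirialFluxGap.FrameDerivative

open scoped Matrix.Norms.Frobenius

attribute [local instance 2000] Literature.MathematicalPhysics.QuantumFieldTheory.SUNBakryEmery.matTop

/-! ## §1 The one-variable logarithm letter -/

/-- ★ **The SU(2) logarithm letter.**  For `A, B ∈ SU(2)` with `‖B − A‖_F < 1/4`, `Y := log(AᴴB)` is skew-Hermitian and traceless, with
`A·e^Y = B` and `‖Y‖_F ≤ 2‖B − A‖_F`. [cite: Balaban1985Averaging, (21), (26) p. 21–22] -/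
theorem su2_log_letter (A B : SU2) (hAB : ‖(B : Matrix (Fin 2) (Fin 2) ℂ) - (A : Matrix (Fin 2) (Fin 2) ℂ)‖ < 1 / 4) :
    (mlog ((A : Matrix (Fin 2) (Fin 2) ℂ)ᴴ * (B : Matrix (Fin 2) (Fin 2) ℂ)))ᴴ =
        -mlog ((A : Matrix (Fin 2) (Fin 2) ℂ)ᴴ * (B : Matrix (Fin 2) (Fin 2) ℂ)) ∧
      (mlog ((A : Matrix (Fin 2) (Fin 2) ℂ)ᴴ * (B : Matrix (Fin 2) (Fin 2) ℂ))).trace = 0 ∧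
      (A : Matrix (Fin 2) (Fin 2) ℂ) * NormedSpace.exp (mlog ((A : Matrix (Fin 2) (Fin 2) ℂ)ᴴ * (B : Matrix (Fin 2) (Fin 2) ℂ))) =
        (B : Matrix (Fin 2) (Fin 2) ℂ) ∧
      ‖mlog ((A : Matrix (Fin 2) (Fin 2) ℂ)ᴴ * (B : Matrix (Fin 2) (Fin 2) ℂ))‖ ≤
        2 * ‖(B : Matrix (Fin 2) (Fin 2) ℂ) - (A : Matrix (Fin 2) (Fin 2) ℂ)‖ := by
  set a : Matrix (Fin 2) (Fin 2) ℂ := (A : Matrix (Fin 2) (Fin 2) ℂ) with ha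
  set b : Matrix (Fin 2) (Fin 2) ℂ := (B : Matrix (Fin 2) (Fin 2) ℂ) with hb
  set W : Matrix (Fin 2) (Fin 2) ℂ := aᴴ * b with hW
  have hAu : a ∈ Matrix.unitaryGroup (Fin 2) ℂ := (Matrix.mem_specialUnitaryGroup_iff.mp A.2).1
  have hBu : b ∈ Matrix.unitaryGroup (Fin 2) ℂ := (Matrix.mem_specialUnitaryGroup_iff.mp B.2).1
  have haa : a * aᴴ = 1 := by
    rw [← Matrix.star_eq_conjTranspose]; exact Matrix.mem_unitaryGroup_iff.1 hAu
  have haa' : aᴴ * a = 1 := by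
    rw [← Matrix.star_eq_conjTranspose]; exact Matrix.mem_unitaryGroup_iff'.1 hAu
  have hau : aᴴ ∈ Matrix.unitaryGroup (Fin 2) ℂ := by
    rw [← Matrix.star_eq_conjTranspose]; exact Unitary.star_mem hAu
  have hWu : W ∈ Matrix.unitaryGroup (Fin 2) ℂ := mul_mem hau hBu
  -- `‖W − 1‖ = ‖aᴴ(b − a)‖ = ‖b − a‖`
  have hW1 : ‖W - 1‖ = ‖b - a‖ := by
    have e : W - 1 = aᴴ * (b - a) := by rw [Matrix.mul_sub, haa', hW]
    rw [e, ← frobNorm_eq_norm, frobNorm_unitary_mul hau, frobNorm_eq_norm]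
  have hW4 : ‖W - 1‖ < 1 / 4 := by rw [hW1]; exact hAB
  have hW2 : ‖W - 1‖ ≤ 1 / 2 := by linarith
  have hWlt1 : ‖W - 1‖ < 1 := by linarith
  -- skewness, the exponential, the norm
  have hskew : (mlog W)ᴴ = -mlog W := by
    rw [← Matrix.star_eq_conjTranspose]; exact star_mlog_of_mem_unitaryGroup hWu hW4
  have hexp : NormedSpace.exp (mlog W) = W := exp_mlog hWlt1
  have hnorm : ‖mlog W‖ ≤ 2 * ‖b - a‖ := by rw [← hW1]; exact norm_mlog_le_two_mul hW2
  -- tracelessness: `e^{tr Y} = det e^Y = det W = 1`, `|tr Y| ≤ 2‖Y‖ < 1 < 2π`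
  have hdetW : W.det = 1 := by
    rw [hW, Matrix.det_mul, Matrix.det_conjTranspose, (Matrix.mem_specialUnitaryGroup_iff.mp A.2).2,
      (Matrix.mem_specialUnitaryGroup_iff.mp B.2).2, star_one, mul_one]
  have htr : (mlog W).trace = 0 := by
    have h1' : NormedSpace.exp ((mlog W).trace) = (1 : ℂ) := by
      have h := Literature.Analysis.Matrix.det_exp_eq_exp_trace (mlog W)
      rw [← h]
      calc _ = W.det := by (convert congrArg Matrix.det hexp using 2) <;> rfl
        _ = 1 := hdetW
    have h1 : Complex.exp (mlog W).trace = 1 := by rw [Complex.exp_eq_exp_ℂ]; exact h1'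
    obtain ⟨n, hn⟩ := Complex.exp_eq_one_iff.1 h1
    -- the trace of a `2×2` matrix is bounded by twice its Frobenius norm (two diagonal entries)
    have htrace : ∀ Y : Matrix (Fin 2) (Fin 2) ℂ, ‖Y.trace‖ ≤ 2 * ‖Y‖ := by
      intro Y
      rw [Matrix.trace_fin_two]
      have h0 := norm_entry_le_frobNorm Y 0 0
      have h1 := norm_entry_le_frobNorm Y 1 1
      rw [frobNorm_eq_norm] at h0 h1
      calc ‖Y 0 0 + Y 1 1‖ ≤ ‖Y 0 0‖ + ‖Y 1 1‖ := norm_add_le _ _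
        _ ≤ 2 * ‖Y‖ := by linarith
    have hsmall : ‖(mlog W).trace‖ < 1 := by
      calc ‖(mlog W).trace‖ ≤ 2 * ‖mlog W‖ := htrace _
        _ ≤ 2 * (2 * ‖W - 1‖) := by linarith [norm_mlog_le_two_mul hW2]
        _ < 1 := by linarith
    have hn0 : n = 0 := by
      by_contra hne
      have h1le : (1 : ℝ) ≤ |(n : ℝ)| := by
        have : (1 : ℤ) ≤ |n| := Int.one_le_abs hne
        exact_mod_cast this
      have hnormn : ‖(n : ℂ) * (2 * Real.pi * Complex.I)‖ = |(n : ℝ)| * (2 * Real.pi) := by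
        rw [norm_mul, Complex.norm_intCast]
        congr 1
        rw [norm_mul, norm_mul, Complex.norm_I, mul_one, Complex.norm_real, Complex.norm_ofNat,
          Real.norm_of_nonneg Real.pi_pos.le]
      rw [hn, hnormn] at hsmall
      have hπ : 3 < Real.pi := Real.pi_gt_three
      nlinarith
    rw [hn, hn0]; simp
  exact ⟨hskew, htr, by rw [hexp, hW, ← Matrix.mul_assoc, haa, Matrix.one_mul], hnorm⟩

/-! ## §2 Nearby ring histories are multi-direction translates -/

variable {L : ℕ} [NeZero L]

omit [NeZero L] in
/-- ★★ **A slot-by-slot nearby ring history is a multi-direction translate**: if `‖Q_w − P_w‖_F < 1/4` at every slice link and seam site,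
there is a skew-Hermitian traceless assignment `Y` (the slot logarithms) with `P·multiCurve Y 1 = Q` and `‖Y_w‖ ≤ 2‖Q_w − P_w‖`. [folklore] -/
theorem exists_multiCurve_eq_of_near (P Q : ((Fin (2 * L - 1 + 1) → GaugeConfig 3 L SU2) × (Site 3 L → SU2)))
    (hnear1 : ∀ (i : Fin (2 * L - 1 + 1)) (e : Edge 3 L),
      ‖(Q.1 i e : Matrix (Fin 2) (Fin 2) ℂ) - (P.1 i e : Matrix (Fin 2) (Fin 2) ℂ)‖ < 1 / 4)
    (hnear2 : ∀ x : Site 3 L, ‖(Q.2 x : Matrix (Fin 2) (Fin 2) ℂ) - (P.2 x : Matrix (Fin 2) (Fin 2) ℂ)‖ < 1 / 4) :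
    ∃ (Y : ((Fin (2 * L - 1 + 1) × Edge 3 L) ⊕ Site 3 L) → Matrix (Fin 2) (Fin 2) ℂ) (hY : ∀ w, (Y w)ᴴ = -Y w) (hY0 : ∀ w, (Y w).trace = 0),
      P * multiCurve Y hY hY0 1 = Q ∧
      (∀ (i : Fin (2 * L - 1 + 1)) (e : Edge 3 L),
        ‖Y (Sum.inl (i, e))‖ ≤ 2 * ‖(Q.1 i e : Matrix (Fin 2) (Fin 2) ℂ) - (P.1 i e : Matrix (Fin 2) (Fin 2) ℂ)‖) ∧
      (∀ x : Site 3 L, ‖Y (Sum.inr x)‖ ≤ 2 * ‖(Q.2 x : Matrix (Fin 2) (Fin 2) ℂ) - (P.2 x : Matrix (Fin 2) (Fin 2) ℂ)‖) := by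
  -- the slot of a ring history at a variable, as an element of `SU(2)`
  let slot : ((Fin (2 * L - 1 + 1) → GaugeConfig 3 L SU2) × (Site 3 L → SU2)) → ((Fin (2 * L - 1 + 1) × Edge 3 L) ⊕ Site 3 L) → SU2 := fun R w =>
    match w with
    | Sum.inl ie => R.1 ie.1 ie.2
    | Sum.inr x => R.2 x
  have hnear : ∀ w : ((Fin (2 * L - 1 + 1) × Edge 3 L) ⊕ Site 3 L), ‖(slot Q w : Matrix (Fin 2) (Fin 2) ℂ) - (slot P w : Matrix (Fin 2) (Fin 2) ℂ)‖ < 1 / 4 := by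
    intro w; rcases w with ⟨i, e⟩ | x
    · exact hnear1 i e
    · exact hnear2 x
  have hletter := fun w => su2_log_letter (slot P w) (slot Q w) (hnear w)
  refine ⟨fun w => mlog ((slot P w : Matrix (Fin 2) (Fin 2) ℂ)ᴴ * (slot Q w : Matrix (Fin 2) (Fin 2) ℂ)),
    fun w => (hletter w).1, fun w => (hletter w).2.1, ?_, fun i e => (hletter (Sum.inl (i, e))).2.2.2,
    fun x => (hletter (Sum.inr x)).2.2.2⟩
  -- `P · exp(Y) = Q` slot by slot
  refine Prod.ext ?_ ?_
  · funext i e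
    apply Subtype.ext
    have h := (hletter (Sum.inl (i, e))).2.2.1
    simp only [Prod.fst_mul, Pi.mul_apply, Submonoid.coe_mul, multiCurve, coe_expSU, one_smul]
    exact h
  · funext x
    apply Subtype.ext
    have h := (hletter (Sum.inr x)).2.2.1
    simp only [Prod.snd_mul, Pi.mul_apply, Submonoid.coe_mul, multiCurve, coe_expSU, one_smul]
    exact h

/-! ## §3 Standard coordinates of the logarithm -/

/-- ★★ **Standard coordinates of a nearby ring history.**  If `‖Q_w − P_w‖_F < 1/4` slot by slot then there is `u : Var × Fin 3 → ℝ` with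
`P·multiCurve (Σ_j u_j τ_j) 1 = Q` for the standard frame `τ = stdFrame` and `|u|² ≤ 48·Σ_w ‖Q_w − P_w‖²` — the input (ii) of
✓`generic_drive_lower` ∕ ✓`generic_divergence_upper` once `Q` is a zero of `F₀` with `Σ_w ‖Q_w − P_w‖² ≤ poly(L)·F₀(P)/ρ²` (w2's
✓`RegularValley.exists_flat_ring_near_of_far`). [folklore] -/
theorem exists_stdCoord_of_near (P Q : ((Fin (2 * L - 1 + 1) → GaugeConfig 3 L SU2) × (Site 3 L → SU2)))
    (hnear1 : ∀ (i : Fin (2 * L - 1 + 1)) (e : Edge 3 L),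
      ‖(Q.1 i e : Matrix (Fin 2) (Fin 2) ℂ) - (P.1 i e : Matrix (Fin 2) (Fin 2) ℂ)‖ < 1 / 4)
    (hnear2 : ∀ x : Site 3 L, ‖(Q.2 x : Matrix (Fin 2) (Fin 2) ℂ) - (P.2 x : Matrix (Fin 2) (Fin 2) ℂ)‖ < 1 / 4) :
    ∃ u : ((Fin (2 * L - 1 + 1) × Edge 3 L) ⊕ Site 3 L) × Fin 3 → ℝ,
      P * multiCurve (dirOf (stdFrame (L := L)) u) (dirOf_conjTranspose (fun j w => stdFrame_conjTranspose j w) u)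
          (dirOf_trace (fun j w => stdFrame_trace j w) u) 1 = Q ∧
      u ⬝ᵥ u ≤ 48 * ((∑ i : Fin (2 * L - 1 + 1), ∑ e : Edge 3 L,
          ‖(Q.1 i e : Matrix (Fin 2) (Fin 2) ℂ) - (P.1 i e : Matrix (Fin 2) (Fin 2) ℂ)‖ ^ 2) +
        ∑ x : Site 3 L, ‖(Q.2 x : Matrix (Fin 2) (Fin 2) ℂ) - (P.2 x : Matrix (Fin 2) (Fin 2) ℂ)‖ ^ 2) := by
  classical
  obtain ⟨Y, hY, hY0, hPQ, hY1, hY2⟩ := exists_multiCurve_eq_of_near P Q hnear1 hnear2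
  refine ⟨stdCoord Y, ?_, ?_⟩
  · have hdir : dirOf (stdFrame (L := L)) (stdCoord Y) = Y := dirOf_stdFrame_stdCoord hY hY0
    have hmc : ∀ (Y₁ Y₂ : ((Fin (2 * L - 1 + 1) × Edge 3 L) ⊕ Site 3 L) → Matrix (Fin 2) (Fin 2) ℂ) (h₁ : ∀ w, (Y₁ w)ᴴ = -Y₁ w) (h₁0 : ∀ w, (Y₁ w).trace = 0)
        (h₂ : ∀ w, (Y₂ w)ᴴ = -Y₂ w) (h₂0 : ∀ w, (Y₂ w).trace = 0), Y₁ = Y₂ → multiCurve Y₁ h₁ h₁0 1 = multiCurve Y₂ h₂ h₂0 1 := by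
      intro Y₁ Y₂ h₁ h₁0 h₂ h₂0 h
      subst h
      rfl
    rw [hmc _ _ _ _ hY hY0 hdir]
    exact hPQ
  · have h1 := stdCoord_sq_le (L := L) Y
    have hsplit : ∑ w : ((Fin (2 * L - 1 + 1) × Edge 3 L) ⊕ Site 3 L), ‖Y w‖ ^ 2 =
        (∑ i : Fin (2 * L - 1 + 1), ∑ e : Edge 3 L, ‖Y (Sum.inl (i, e))‖ ^ 2) + ∑ x : Site 3 L, ‖Y (Sum.inr x)‖ ^ 2 := by
      rw [Fintype.sum_sum_type, Fintype.sum_prod_type]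
    have h2 : (∑ i : Fin (2 * L - 1 + 1), ∑ e : Edge 3 L, ‖Y (Sum.inl (i, e))‖ ^ 2) ≤
        ∑ i : Fin (2 * L - 1 + 1), ∑ e : Edge 3 L, (2 * ‖(Q.1 i e : Matrix (Fin 2) (Fin 2) ℂ) - (P.1 i e : Matrix (Fin 2) (Fin 2) ℂ)‖) ^ 2 :=
      Finset.sum_le_sum fun i _ => Finset.sum_le_sum fun e _ => pow_le_pow_left₀ (norm_nonneg _) (hY1 i e) 2
    have h3 : ∑ x : Site 3 L, ‖Y (Sum.inr x)‖ ^ 2 ≤ ∑ x : Site 3 L, (2 * ‖(Q.2 x : Matrix (Fin 2) (Fin 2) ℂ) - (P.2 x : Matrix (Fin 2) (Fin 2) ℂ)‖) ^ 2 :=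
      Finset.sum_le_sum fun x _ => pow_le_pow_left₀ (norm_nonneg _) (hY2 x) 2
    have e2 : ∑ i : Fin (2 * L - 1 + 1), ∑ e : Edge 3 L, (2 * ‖(Q.1 i e : Matrix (Fin 2) (Fin 2) ℂ) - (P.1 i e : Matrix (Fin 2) (Fin 2) ℂ)‖) ^ 2 =
        4 * ∑ i : Fin (2 * L - 1 + 1), ∑ e : Edge 3 L, ‖(Q.1 i e : Matrix (Fin 2) (Fin 2) ℂ) - (P.1 i e : Matrix (Fin 2) (Fin 2) ℂ)‖ ^ 2 := by
      rw [Finset.mul_sum]; refine Finset.sum_congr rfl fun i _ => ?_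
      rw [Finset.mul_sum]; refine Finset.sum_congr rfl fun e _ => by ring
    have e3 : ∑ x : Site 3 L, (2 * ‖(Q.2 x : Matrix (Fin 2) (Fin 2) ℂ) - (P.2 x : Matrix (Fin 2) (Fin 2) ℂ)‖) ^ 2 =
        4 * ∑ x : Site 3 L, ‖(Q.2 x : Matrix (Fin 2) (Fin 2) ℂ) - (P.2 x : Matrix (Fin 2) (Fin 2) ℂ)‖ ^ 2 := by
      rw [Finset.mul_sum]; refine Finset.sum_congr rfl fun x _ => by ring
    rw [hsplit] at h1
    linarith

end Summit.QuantumFields.YangMills.Theorems.VirialFluxGap.FrameHessian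

end
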